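import Literature.Analysis.FluidPDE.TaoClassSymmetry
import Literature.Analysis.FluidPDE.ClassicalSolutionRescale
import HarnessLib

/-!
# Tao's class is invariant under space translations and rigid placements

Companion to `TaoClassSymmetry` (conjugation by a linear isometry): a Tao-class solution
(`IsTaoSolutionOn T ν u₀ u p`: classical on `[0, T] × ℝ³`, zero force, all Sobolev norms of
`u`, `∂ₜu`, `p` bounded, `u ∈ C([0, T]; L²)`, datum `u₀`; Tao 2011, Theorem 5.4) stays in the class
under the space translation `x ↦ b + x` (`IsTaoSolutionOn.spaceTranslate`) and hence under every
rigid placement `x ↦ A x + b` with `A` a linear isometry (`IsTaoSolutionOn.rigidPlacement`, the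
velocity transforming as a vector: `x ↦ A⁻¹ (u t (A x + b))`). The Navier–Stokes system has
constant coefficients, so translates of solutions are solutions (Majda–Bertozzi 2002, §1.2,
Prop. 1.1: "by straightforward inspection"); every defining bound of the class is an integral
over `ℝ³` of a translate, hence unchanged (Lebesgue measure is translation invariant), and the
time derivative commutes with a substitution in the space variable.

USE: `PalasekTowerLiveClassAt.DeadSlice w = ∃ A b, IsAxisymmetric (conjSlice A b w) ∧ HasNoSwirl
(conjSlice A b w)` with `conjSlice A b w x = A⁻¹ (w (A x + b))`; with `rigidPlacement` the
equivariance propagation `TaoClassSymmetry.isAxisymmetric_hasNoSwirl_on_Icc` and backward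
uniqueness in Tao's class apply to a placed Tao-class flow for every viscosity `ν > 0`, without
the datum-decay / finite-energy detour of the `ν = 1` classical version.

## What this records / does not claim
[folklore] symmetry bookkeeping; sorry-free. No regularity statement; nothing about blow-up.
-/

noncomputable section

open MeasureTheory Set Function Filter Topology
open scoped ENNReal NNReal ContDiff

namespace Literature.Analysis.FluidPDE

/-! ## Translation invariance of the integrals defining the class -/

section Shift

variable {F : Type*} [NormedAddCommGroup F] [NormedSpace ℝ F]

/-- `∫ ‖Dⁿ(w(b + ·))‖² = ∫ ‖Dⁿ w‖²`: `Dⁿ(w(b + ·))(x) = (Dⁿ w)(b + x)` and Lebesgue measure is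
translation invariant. [folklore] -/
private theorem lintegral_iteratedFDeriv_spaceShift (b : EuclideanSpace ℝ (Fin 3))
    (w : EuclideanSpace ℝ (Fin 3) → F) (n : ℕ) :
    ∫⁻ x, ‖iteratedFDeriv ℝ n (fun x => w (b + x)) x‖ₑ ^ 2 =
      ∫⁻ x, ‖iteratedFDeriv ℝ n w x‖ₑ ^ 2 := by
  simp_rw [iteratedFDeriv_comp_add_left]
  exact lintegral_add_left_eq_self (fun y => ‖iteratedFDeriv ℝ n w y‖ₑ ^ 2) b

/-- The time derivative within a time set commutes with a substitution in the space variable.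
[folklore] -/
private theorem timeDerivWithin_spaceShift (S : Set ℝ) (u : ℝ → EuclideanSpace ℝ (Fin 3) → F)
    (b : EuclideanSpace ℝ (Fin 3)) (t : ℝ) :
    timeDerivWithin S (fun s x => u s (b + x)) t = fun x => timeDerivWithin S u t (b + x) :=
  rfl

end Shift

/-! ## Tao's class under translations and rigid placements -/

namespace IsTaoSolutionOn

variable {T ν : ℝ} {u₀ : EuclideanSpace ℝ (Fin 3) → EuclideanSpace ℝ (Fin 3)}
  {u : ℝ → EuclideanSpace ℝ (Fin 3) → EuclideanSpace ℝ (Fin 3)}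
  {p : ℝ → EuclideanSpace ℝ (Fin 3) → ℝ}

/-- **Tao's class is translation invariant.** If `(u, p)` is a Tao-class solution on `[0, T]`
with datum `u₀`, then `(t, x) ↦ u t (b + x)`, `(t, x) ↦ p t (b + x)` is a Tao-class solution on
`[0, T]` with the same viscosity and datum `u₀ (b + ·)` (constant coefficients, Majda–Bertozzi
2002, §1.2, Prop. 1.1; the Sobolev and `L²` quantities of Tao 2011, Theorem 5.4, are
translation invariant). [cite: MajdaBertozziCUP2002, §1.2 Prop. 1.1 (p. 12)] -/
theorem spaceTranslate (h : IsTaoSolutionOn T ν u₀ u p) (b : EuclideanSpace ℝ (Fin 3)) :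
    IsTaoSolutionOn T ν (fun x => u₀ (b + x)) (fun t x => u t (b + x))
      (fun t x => p t (b + x)) := by
  have hcl : IsClassicalNSSolutionOn (Icc 0 T) ν 0 (fun t x => u t (b + x))
      (fun t x => p t (b + x)) :=
    (h.classical.spaceTranslate b).congr_force fun t _ x => by simp
  have hmp : MeasurePreserving (fun x : EuclideanSpace ℝ (Fin 3) => b + x) volume volume :=
    measurePreserving_add_left volume b
  refine ⟨hcl, ?_, ?_, ?_, ?_, ?_⟩
  · -- datum
    funext x
    simp [h.initial]
  · -- Sobolev bounds of the velocity
    intro n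
    obtain ⟨C, hC⟩ := h.sobolev n
    exact ⟨C, fun t ht => by rw [lintegral_iteratedFDeriv_spaceShift]; exact hC t ht⟩
  · -- Sobolev bounds of the time derivative
    intro n
    obtain ⟨C, hC⟩ := h.sobolev_dt n
    refine ⟨C, fun t ht => ?_⟩
    rw [timeDerivWithin_spaceShift, lintegral_iteratedFDeriv_spaceShift]
    exact hC t ht
  · -- Sobolev bounds of the pressure
    intro n
    obtain ⟨C, hC⟩ := h.sobolev_p n
    exact ⟨C, fun t ht => by rw [lintegral_iteratedFDeriv_spaceShift]; exact hC t ht⟩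
  · -- `L²`-continuity in time
    refine ⟨fun t ht => (h.continuousL2.1 t ht).comp_measurePreserving hmp, fun t₀ ht₀ => ?_⟩
    refine (h.continuousL2.2 t₀ ht₀).congr' ?_
    filter_upwards [self_mem_nhdsWithin] with t ht
    have hsub : ((fun x => u t (b + x)) - fun x => u t₀ (b + x)) =
        (u t - u t₀) ∘ fun x => b + x := rfl
    rw [hsub, eLpNorm_comp_measurePreserving
      ((h.aestronglyMeasurable_slice ht).sub (h.aestronglyMeasurable_slice ht₀)) hmp]

/-- **Tao's class is invariant under rigid placements.** For a linear isometry `A` of `ℝ³` and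
`b ∈ ℝ³`, the placed pair `(t, x) ↦ A⁻¹ (u t (A x + b))`, `(t, x) ↦ p t (A x + b)` is a Tao-class
solution on `[0, T]` (`0 < T`) with datum `x ↦ A⁻¹ (u₀ (A x + b))`: translate by `b`
(`spaceTranslate`), then conjugate by `A⁻¹` (`conj_linearIsometryEquiv`).
[cite: MajdaBertozziCUP2002, §1.2 Prop. 1.1 (ii) (p. 13)] -/
theorem rigidPlacement (h : IsTaoSolutionOn T ν u₀ u p) (hT : 0 < T)
    (A : EuclideanSpace ℝ (Fin 3) ≃ₗᵢ[ℝ] EuclideanSpace ℝ (Fin 3)) (b : EuclideanSpace ℝ (Fin 3)) :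
    IsTaoSolutionOn T ν (fun x => A.symm (u₀ (A x + b))) (fun t x => A.symm (u t (A x + b)))
      (fun t x => p t (A x + b)) := by
  have h1 := (h.spaceTranslate b).conj_linearIsometryEquiv A.symm hT
  have e0 : (fun x => A.symm ((fun x => u₀ (b + x)) (A.symm.symm x))) =
      fun x => A.symm (u₀ (A x + b)) := by
    funext x; simp [add_comm]
  have e1 : (fun t x => A.symm ((fun t x => u t (b + x)) t (A.symm.symm x))) =
      fun t x => A.symm (u t (A x + b)) := by
    funext t x; simp [add_comm]
  have e2 : (fun t x => (fun t x => p t (b + x)) t (A.symm.symm x)) =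
      fun t x => p t (A x + b) := by
    funext t x; simp [add_comm]
  rw [e0, e1, e2] at h1
  exact h1

end IsTaoSolutionOn

end Literature.Analysis.FluidPDE

end
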